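import Mathlib

/-!
# `Balaban1983to89.B9Eq342GradientRowBootstrap` — T. Bałaban, *Propagators for lattice gauge theories in a background field*, Commun. Math. Phys. **99** (1985)
# 389–434 [Balaban1985BackgroundPropagators] Thm 3.1 (3.42) p. 397, SECOND entry (the covariant-gradient row `|(∇_U G′(U)λ)(x)| ≤ B₀·(L^jη)⁻¹·e^{−δ₀d(y,y′)}`):
# **THE GRADIENT-ROW BOOTSTRAP — the fixed point of a WEIGHTED SUP NORM over a finite set of output bonds, in `∃`-free closed form:
# if every weighted bound `M` of a bond field `D` improves to `A + θ·M` with `θ < 1`, then `A∕(1 − θ)` is a weighted bound; composed with a kernel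
# representation per bond, a gradient-kernel ROW LETTER `Σ_y ‖k b y‖·w y ≤ S·w′ b`, weighted data and a perturbation that feeds the unknown back with
# coefficient `ε₁`, the output is `‖D b‖ ≤ (S(Γ + ε₂N) + ε₀N)∕(1 − S·ε₁)·w′ b`** — the abstract (N) step of «storey J» (the ∇-row of (3.42) by a contraction in
# the weighted sup norm) of the NE9 chain, the ∇-twin of the VALUE-row bootstrap `B9Eq342SupNormBootstrap` ∕ `B9Eq342SupNormBootstrapWeighted`

statement-level skeleton of published theorems with citation tags; proofs where landed; nothing here is a claim about the Yang–Mills mass gap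

CITATION HEADER (lean-in-tree rule).  Audit cell `pub-balaban`, sub-cell `t4`, BINDER row NE9; filed by NE9 crux-team LEAF PROVER 05
(`b2b-balaban-t4-ne9-formalise-leaf-05`, gen 82).  MATHEMATICS: t4-ne9-idea-1 (NE9 crux ideation lens 1 = analytic dependence ∕ fixed point), gen 121
`t4/ideate/NE9/lens1-g121/NABLA-ROW-STOREY-J-INTERFACE-g121.md` §1 (certificate `StoreyJ_skeleton_g121.NOT-TO-FILE.lean` 2663f40e77007ef4: `le_div_of_le_add_mul`,
`weighted_bound_of_bootstrap`, `norm_sum_smul_le`, `storeyJ_closed_form`) and gen 135 `lens1-g135/ROW-CENTRE-PROFILE-g135.md` (N36) §4 (`storeyJ_two_constants`,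
`storeyJ_two_constants_closed`) — credit theirs; ported here to the tree (kernel over a normed field `𝕂`, `‖k b y‖` in place of `|k b y|`, so that a real kernel
coerced into `ℂ` and `𝔤ᶜ`-valued data are covered).  SOURCE READ first-hand in the held text layer [Balaban1985BackgroundPropagators]
(`paper:balaban1985-cmp99-background-propagators`, journal page = PDF page + 388) p. 397 Thm 3.1 *«There exist positive constants M₁, δ₀, α₀, B₀ dependent on d
and L only …»*, (3.42) second line (the `∇_U G′(U)λ` entry), p. 398 *«All these inequalities are invariant with respect to gauge transformations of U»* and
*«We will prove the above theorem by constructing a random walk representation similar to that in (2.40) …»* — print's engine for the ∇-row is the random-walk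
expansion of [Balaban1984PropagatorsII]; NOTHING of it is reproduced.  This file is the cell's SUBSTITUTE engine for that row, abstract half: a contraction in a
weighted sup norm (textbook: the Banach fixed point read on the finite-dimensional weighted `ℓ^∞`; METHOD only, nothing printed is a hypothesis).

WHY THIS FILE (cell context).  The OWNER's SUP-NORM PROGRAMME (`t4/b2b-balaban-t4-ne9-p1/g89/SUP-NORM-PROGRAMME.md`, plan v10) obtains the VALUE row of (3.42)
by positivity ((K)+(MP)+(A): `B9Eq323KatoDomination`, `B9Eq342SupNormBootstrap(Weighted)`) and lists the ∇-row as OPEN (5) «NOT by positivity».  Storey J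
(t4-ne9-idea-1 gens 111–135) is the non-positivity skeleton for that row: per output bond `b = (x, μ)` a representation
`D b = Σ_y k b y • (g b y − V b y) + (conversion)` through the FLAT (or pure-gauge) resolvent's gradient kernel `k`, whose weighted row
`Σ_y ‖k b y‖·w y ≤ S·w′ b` is the (K∇) letter (this lineage's `B5Eq129FreeResolventGradientRow` ∕ `…WeightedGradientRowCosh` ∕ `…WeightedGradientRowOperator`:
`S ≤ 2∕√(4 + η²)` unweighted, `S(κ)` explicit in the product-`cosh` currency), data `g` bounded by the weight (sources, penalty, the VALUE row `N` of storey (D)),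
and a perturbation `V` (background − pure gauge on a ball, cutoff commutator) bounded by `(ε₁·M + ε₂·N)·w` for every weighted bound `M` of `D` itself.  The
unknown `M = sup_b ‖D b‖∕w′ b` is absorbed when `θ = S·ε₁ < 1`.  This file types exactly that absorption, with every constant displayed and no `∃`.

WHAT IS PROVED (sorry-free; 0 `def`; [folklore]).  `X` (sites) and `Y` (bonds) finite types, `E` a seminormed `𝕂`-space over a normed field `𝕂`, weights
`w : X → ℝ`, `w′ : Y → ℝ` with `0 < w′`.
* §1 **`norm_le_weight_mul_of_bootstrap`** — THE FIXED POINT OF THE WEIGHTED SUP: `θ < 1`,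
  `∀ M ≥ 0, (∀ b, ‖D b‖ ≤ M·w′ b) → ∀ b, ‖D b‖ ≤ (A + θ·M)·w′ b`  ⊢  `∀ b, ‖D b‖ ≤ A∕(1 − θ)·w′ b` (the attained weighted sup `Finset.sup'`; g121
  `weighted_bound_of_bootstrap`).  **`norm_sum_smul_le_mul_rowSum`** — weighted Young: `(∀ y, ‖v y‖ ≤ C·w y) → ‖Σ_y k y • v y‖ ≤ C·Σ_y ‖k y‖·w y` (g121
  `norm_sum_smul_le`).
* §2 **`norm_le_of_gradient_row_bootstrap`** (g121 `storeyJ_closed_form`) — constants `S ε₀ ε₁ ε₂ Γ N` (`0 ≤ ε₁, ε₂, Γ, N`), `S·ε₁ < 1`;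
  (REP) `‖D b‖ ≤ ‖Σ_y k b y • (g b y − V b y)‖ + ε₀·N·w′ b`; (K∇) `Σ_y ‖k b y‖·w y ≤ S·w′ b`; (DATA) `‖g b y‖ ≤ Γ·w y`;
  (PERT) `∀ M ≥ 0, (∀ b, ‖D b‖ ≤ M·w′ b) → ‖V b y‖ ≤ (ε₁·M + ε₂·N)·w y`  ⊢  `∀ b, ‖D b‖ ≤ (S·(Γ + ε₂·N) + ε₀·N)∕(1 − S·ε₁)·w′ b`.
* §3 **`norm_le_of_gradient_row_bootstrap_two`** ∕ **`norm_le_of_gradient_row_bootstrap_two_closed`** (N36 §4 `storeyJ_two_constants(_closed)`) — with, AT THE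
  READ-OFF BOND `b₀`, its own row constant `Σ_y ‖k b₀ y‖·w y ≤ S₀·w′ b₀` and `0 ≤ ε₀·N` (no order between `S₀` and `S` is assumed: for `S ≤ S₀` the
  every-bond form is already the stronger one):  `‖D b₀‖ ≤ (S₀·(Γ + ε₂·N) + ε₀·N)∕(1 − S·ε₁)·w′ b₀` — the every-bond constant `S` in the θ-slot, the read-off
  bond's `S₀` in the data slot (N36 §3: in the product-`cosh` currency `S` is the EVERY-CENTRE letter of
  `B5Eq129FreeResolventWeightedGradientRowCosh.sum_weight_mul_abs_sub_le_explicit`, `S₀` the on-slice one `…_of_centre_on_slice_explicit`).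
* §4 OPERATOR (solution) SHAPE **`norm_le_of_gradient_response_bootstrap`** ∕ **`…_response_bootstrap_two_closed`** — the kernel row replaced by a response map
  `T b : (X → E) → E` with the letter `‖h‖ ≤ F·w ⟹ ‖T b h‖ ≤ S·F·w′ b` (idea-1 g121 §2 (K∇′); the shape of
  `B5Eq129FreeResolventWeightedGradientRowOperator.norm_apply_sub_le_of_resolvent_weighted`: `T (x, μ) h = η⁻¹(v(x+e_μ) − v(x))`, `(L₀+m)v = h`); same outputs.
DICTIONARY (top level; idea-1 g121 §1): `D b = (∇_U G′(U)f)(b)`; `w, w′` the decay weights of storey (D) (sites ∕ bonds); `N` = the VALUE-row bound of storey (D);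
`S` = (K∇); `ε₁ = 2c_χ∕r + 2d·a` (cutoff commutator `B9Eq323KatoCutoffCommutator` + the ball-gauge letter of print's regularity condition (3.35) p. 396);
`ε₂·N`, `ε₀·N` = the `(d_μa_μ)`, `a a*`, `(d*dχ)` and `a·u` terms; `Γ` = sources `f`, penalty `q`, and `u` through `N`.
HONEST SCOPE.  Abstract algebra of the absorption; NO instance (the letters (K∇) are this lineage's files, (CO) is `B9Eq323KatoCutoffCommutator`, (REP)∕(PERT)∕the
ball-gauge letter are NOT in the tree); storey J is ONE un-opened storey of row L13 of `t4/ROUTES-NE9.md` (R2′ side-letter); nothing of Bałaban's is asserted, valued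
or discharged.  NOT summit progress (cell pub-balaban: NE9 NOT PRINTED ∕ NOT PROVED; «NE9 ⇐ the named binders»; row WALLED ON A MODEL (O-NE9-1; #5 UNRULED); spine
PROVED 0∕9; rung (B)+1 finite T⁴ — NOT infinite volume, NOT mass gap, NOT BetaPertH, NOT Clay).  HONEST DEPENDENCY (cell line): continuum YM on T⁴ ⇐ BetaPertH ∧ nine
spine estimates (0/9 proved); BetaPertH ⇐ (D1) ∧ (D4) ∧ CAP+tail; G-an2-4 gates asym, D1 and NE2/3/4.  NEW file importing Mathlib only; nothing modified.  Net new
unproved facts: 0.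
-/

open scoped BigOperators

namespace Literature.MathematicalPhysics.QuantumFieldTheory.Balaban1983to89.B9Eq342GradientRowBootstrap

/-- scalar absorption: `x ≤ A + θ·x` with `θ < 1` gives `x ≤ A∕(1 − θ)`. [folklore] -/
private theorem le_div_of_le_add_mul {x A θ : ℝ} (hθ : θ < 1) (h : x ≤ A + θ * x) : x ≤ A / (1 - θ) := by
  rw [le_div_iff₀ (sub_pos.mpr hθ)]
  nlinarith

variable {X Y : Type*} [Fintype X] [Fintype Y]

/-! ## §1 The fixed point of the weighted sup norm; weighted Young -/

/-- **THE ABSORPTION STEP (fixed point of the weighted sup norm over a finite bond set).**  If `0 < w′` and every weighted bound `M ≥ 0` of `D`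
(`‖D b‖ ≤ M·w′ b` for all `b`) improves to the weighted bound `A + θ·M` with `θ < 1`, then `‖D b‖ ≤ A∕(1 − θ)·w′ b` for all `b` — no `∃`: the attained
weighted sup `max_b ‖D b‖∕w′ b` is fed to the hypothesis once.  (t4-ne9-idea-1 g121 `weighted_bound_of_bootstrap`.) [folklore]
[cite: Balaban1985BackgroundPropagators, Thm 3.1 (3.42) p.397] -/
theorem norm_le_weight_mul_of_bootstrap {E : Type*} [SeminormedAddCommGroup E] (D : Y → E) (w' : Y → ℝ) (hw' : ∀ b, 0 < w' b)
    {A θ : ℝ} (hθ : θ < 1) (hboot : ∀ M : ℝ, 0 ≤ M → (∀ b, ‖D b‖ ≤ M * w' b) → ∀ b, ‖D b‖ ≤ (A + θ * M) * w' b) (b : Y) :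
    ‖D b‖ ≤ A / (1 - θ) * w' b := by
  classical
  have hne : (Finset.univ : Finset Y).Nonempty := ⟨b, Finset.mem_univ _⟩
  set M : ℝ := Finset.univ.sup' hne (fun b => ‖D b‖ / w' b) with hM_def
  have hMb : ∀ b, ‖D b‖ ≤ M * w' b := fun b => by
    have h1 : ‖D b‖ / w' b ≤ M := Finset.le_sup' (fun b => ‖D b‖ / w' b) (Finset.mem_univ b)
    rwa [div_le_iff₀ (hw' b)] at h1
  obtain ⟨b₁, -, hb₁⟩ := Finset.exists_mem_eq_sup' hne (fun b => ‖D b‖ / w' b)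
  have h2 : M = ‖D b₁‖ / w' b₁ := by rw [hM_def, hb₁]
  have hM0 : 0 ≤ M := by
    rw [h2]
    exact div_nonneg (norm_nonneg _) (hw' b₁).le
  have hMle : M ≤ A + θ * M := by
    have h3 : ‖D b₁‖ / w' b₁ ≤ A + θ * M := by
      rw [div_le_iff₀ (hw' b₁)]
      exact hboot M hM0 hMb b₁
    rwa [← h2] at h3
  exact (hMb b).trans (mul_le_mul_of_nonneg_right (le_div_of_le_add_mul hθ hMle) (hw' b).le)

/-- **WEIGHTED YOUNG**: a kernel row against data dominated by a weight — `‖v y‖ ≤ C·w y` for all `y` gives `‖Σ_y k y • v y‖ ≤ C·Σ_y ‖k y‖·w y`.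
(t4-ne9-idea-1 g121 `norm_sum_smul_le`, kernel over a normed field.) [folklore] [cite: Balaban1985BackgroundPropagators, Thm 3.1 (3.42) p.397] -/
theorem norm_sum_smul_le_mul_rowSum {𝕂 : Type*} [NormedField 𝕂] {E : Type*} [SeminormedAddCommGroup E] [NormedSpace 𝕂 E]
    (k : X → 𝕂) (v : X → E) (w : X → ℝ) {C : ℝ} (hv : ∀ y, ‖v y‖ ≤ C * w y) :
    ‖∑ y, k y • v y‖ ≤ C * ∑ y, ‖k y‖ * w y := by
  calc ‖∑ y, k y • v y‖ ≤ ∑ y, ‖k y • v y‖ := norm_sum_le _ _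
    _ = ∑ y, ‖k y‖ * ‖v y‖ := Finset.sum_congr rfl fun y _ => norm_smul _ _
    _ ≤ ∑ y, ‖k y‖ * (C * w y) := Finset.sum_le_sum fun y _ => mul_le_mul_of_nonneg_left (hv y) (norm_nonneg _)
    _ = C * ∑ y, ‖k y‖ * w y := by
        rw [Finset.mul_sum]
        exact Finset.sum_congr rfl fun y _ => by ring

/-! ## §2 The gradient-row bootstrap in closed form -/

variable {𝕂 : Type*} [NormedField 𝕂] {E : Type*} [SeminormedAddCommGroup E] [NormedSpace 𝕂 E]

/-- **THE GRADIENT-ROW BOOTSTRAP, CLOSED FORM.**  Bonds `Y`, sites `X` (finite), a bond field `D : Y → E`, per bond a kernel row `k b : X → 𝕂`, data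
`g b` and perturbation `V b : X → E`, weights `w` (sites), `w′ > 0` (bonds), constants `S ε₀ ε₁ ε₂ Γ N` with `0 ≤ ε₁, ε₂, Γ, N` and `S·ε₁ < 1`.  If
(REP) `‖D b‖ ≤ ‖Σ_y k b y • (g b y − V b y)‖ + ε₀·N·w′ b`, (K∇) `Σ_y ‖k b y‖·w y ≤ S·w′ b`, (DATA) `‖g b y‖ ≤ Γ·w y`, and
(PERT) for every weighted bound `M ≥ 0` of `D`, `‖V b y‖ ≤ (ε₁·M + ε₂·N)·w y`, then `‖D b‖ ≤ (S·(Γ + ε₂·N) + ε₀·N)∕(1 − S·ε₁)·w′ b` for every bond.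
Proof: one bootstrap round gives `A + θM` with `A = S(Γ + ε₂N) + ε₀N`, `θ = Sε₁`; then `norm_le_weight_mul_of_bootstrap`.  (t4-ne9-idea-1 g121 `storeyJ_closed_form`;
dictionary in the module docstring: `D = ∇_U G′(U)f`, `S` = the (K∇) letter, `N` = storey (D)'s value row.) [folklore]
[cite: Balaban1985BackgroundPropagators, Thm 3.1 (3.42) p.397] -/
theorem norm_le_of_gradient_row_bootstrap (D : Y → E) (k : Y → X → 𝕂) (g V : Y → X → E) (w : X → ℝ) (w' : Y → ℝ) (hw' : ∀ b, 0 < w' b)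
    {S ε₀ ε₁ ε₂ Γ N : ℝ} (hε₁ : 0 ≤ ε₁) (hε₂ : 0 ≤ ε₂) (hΓ : 0 ≤ Γ) (hN : 0 ≤ N) (hθ : S * ε₁ < 1)
    (hrep : ∀ b, ‖D b‖ ≤ ‖∑ y, k b y • (g b y - V b y)‖ + ε₀ * N * w' b)
    (hk : ∀ b, ∑ y, ‖k b y‖ * w y ≤ S * w' b)
    (hg : ∀ b y, ‖g b y‖ ≤ Γ * w y)
    (hV : ∀ M : ℝ, 0 ≤ M → (∀ b, ‖D b‖ ≤ M * w' b) → ∀ b y, ‖V b y‖ ≤ (ε₁ * M + ε₂ * N) * w y) (b : Y) :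
    ‖D b‖ ≤ (S * (Γ + ε₂ * N) + ε₀ * N) / (1 - S * ε₁) * w' b := by
  refine norm_le_weight_mul_of_bootstrap D w' hw' (A := S * (Γ + ε₂ * N) + ε₀ * N) (θ := S * ε₁) hθ ?_ b
  intro M hM0 hMb b
  have hdat : ∀ y, ‖g b y - V b y‖ ≤ (Γ + (ε₁ * M + ε₂ * N)) * w y := fun y =>
    calc ‖g b y - V b y‖ ≤ ‖g b y‖ + ‖V b y‖ := norm_sub_le _ _
      _ ≤ Γ * w y + (ε₁ * M + ε₂ * N) * w y := add_le_add (hg b y) (hV M hM0 hMb b y)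
      _ = (Γ + (ε₁ * M + ε₂ * N)) * w y := by ring
  have hY : ‖∑ y, k b y • (g b y - V b y)‖ ≤ (Γ + (ε₁ * M + ε₂ * N)) * ∑ y, ‖k b y‖ * w y :=
    norm_sum_smul_le_mul_rowSum (k b) (fun y => g b y - V b y) w hdat
  have hpos : 0 ≤ Γ + (ε₁ * M + ε₂ * N) := by positivity
  calc ‖D b‖ ≤ ‖∑ y, k b y • (g b y - V b y)‖ + ε₀ * N * w' b := hrep b
    _ ≤ (Γ + (ε₁ * M + ε₂ * N)) * (∑ y, ‖k b y‖ * w y) + ε₀ * N * w' b := add_le_add hY le_rfl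
    _ ≤ (Γ + (ε₁ * M + ε₂ * N)) * (S * w' b) + ε₀ * N * w' b := add_le_add (mul_le_mul_of_nonneg_left (hk b) hpos) le_rfl
    _ = (S * (Γ + ε₂ * N) + ε₀ * N + S * ε₁ * M) * w' b := by ring

/-! ## §3 Two row constants: the read-off bond's own letter in the data slot -/

/-- **TWO ROW CONSTANTS, one round unfolded.**  As `norm_le_of_gradient_row_bootstrap`, and at the read-off bond `b₀` its own row letter
`Σ_y ‖k b₀ y‖·w y ≤ S₀·w′ b₀`: `‖D b₀‖ ≤ (S₀·(Γ + (ε₁·M* + ε₂·N)) + ε₀·N)·w′ b₀` with `M* = (S(Γ + ε₂N) + ε₀N)∕(1 − Sε₁)` the every-bond bound — the absorption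
runs in ONE weighted sup over ALL bonds (constant `S`), the last round at `b₀` uses `S₀`.  (t4-ne9-idea-1 g135 N36 §4 `storeyJ_two_constants`.) [folklore]
[cite: Balaban1985BackgroundPropagators, Thm 3.1 (3.42) p.397] -/
theorem norm_le_of_gradient_row_bootstrap_two (D : Y → E) (k : Y → X → 𝕂) (g V : Y → X → E) (w : X → ℝ) (w' : Y → ℝ) (hw' : ∀ b, 0 < w' b)
    {S S₀ ε₀ ε₁ ε₂ Γ N : ℝ} (hε₁ : 0 ≤ ε₁) (hε₂ : 0 ≤ ε₂) (hΓ : 0 ≤ Γ) (hN : 0 ≤ N) (hθ : S * ε₁ < 1)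
    (hrep : ∀ b, ‖D b‖ ≤ ‖∑ y, k b y • (g b y - V b y)‖ + ε₀ * N * w' b)
    (hk : ∀ b, ∑ y, ‖k b y‖ * w y ≤ S * w' b)
    (hg : ∀ b y, ‖g b y‖ ≤ Γ * w y)
    (hV : ∀ M : ℝ, 0 ≤ M → (∀ b, ‖D b‖ ≤ M * w' b) → ∀ b y, ‖V b y‖ ≤ (ε₁ * M + ε₂ * N) * w y)
    (b₀ : Y) (hk₀ : ∑ y, ‖k b₀ y‖ * w y ≤ S₀ * w' b₀) :
    ‖D b₀‖ ≤ (S₀ * (Γ + (ε₁ * ((S * (Γ + ε₂ * N) + ε₀ * N) / (1 - S * ε₁)) + ε₂ * N)) + ε₀ * N) * w' b₀ := by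
  have hMb : ∀ b, ‖D b‖ ≤ (S * (Γ + ε₂ * N) + ε₀ * N) / (1 - S * ε₁) * w' b :=
    norm_le_of_gradient_row_bootstrap D k g V w w' hw' hε₁ hε₂ hΓ hN hθ hrep hk hg hV
  set M : ℝ := (S * (Γ + ε₂ * N) + ε₀ * N) / (1 - S * ε₁) with hM
  have hM0 : 0 ≤ M := by
    by_contra hneg
    have h1 : M * w' b₀ < 0 := mul_neg_of_neg_of_pos (not_le.mp hneg) (hw' b₀)
    linarith [hMb b₀, norm_nonneg (D b₀)]
  have hdat : ∀ y, ‖g b₀ y - V b₀ y‖ ≤ (Γ + (ε₁ * M + ε₂ * N)) * w y := fun y =>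
    calc ‖g b₀ y - V b₀ y‖ ≤ ‖g b₀ y‖ + ‖V b₀ y‖ := norm_sub_le _ _
      _ ≤ Γ * w y + (ε₁ * M + ε₂ * N) * w y := add_le_add (hg b₀ y) (hV M hM0 hMb b₀ y)
      _ = (Γ + (ε₁ * M + ε₂ * N)) * w y := by ring
  have hY : ‖∑ y, k b₀ y • (g b₀ y - V b₀ y)‖ ≤ (Γ + (ε₁ * M + ε₂ * N)) * ∑ y, ‖k b₀ y‖ * w y :=
    norm_sum_smul_le_mul_rowSum (k b₀) (fun y => g b₀ y - V b₀ y) w hdat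
  have hpos : 0 ≤ Γ + (ε₁ * M + ε₂ * N) := by positivity
  calc ‖D b₀‖ ≤ ‖∑ y, k b₀ y • (g b₀ y - V b₀ y)‖ + ε₀ * N * w' b₀ := hrep b₀
    _ ≤ (Γ + (ε₁ * M + ε₂ * N)) * (∑ y, ‖k b₀ y‖ * w y) + ε₀ * N * w' b₀ := add_le_add hY le_rfl
    _ ≤ (Γ + (ε₁ * M + ε₂ * N)) * (S₀ * w' b₀) + ε₀ * N * w' b₀ := add_le_add (mul_le_mul_of_nonneg_left hk₀ hpos) le_rfl
    _ = (S₀ * (Γ + (ε₁ * M + ε₂ * N)) + ε₀ * N) * w' b₀ := by ring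

/-- **TWO ROW CONSTANTS, CLOSED FORM.**  If moreover `0 ≤ ε₀·N`, then `‖D b₀‖ ≤ (S₀·(Γ + ε₂·N) + ε₀·N)∕(1 − S·ε₁)·w′ b₀` — the every-bond constant `S` in
the θ-slot, the read-off bond's `S₀` in the data slot (N36 §3: `S` = the every-centre weighted ∇-row letter, `S₀` = the on-slice one; their ratio is
`2∕(1 + e^{−κη})` on `ℤ^d`).  For `S₀ ≤ S`: `norm_le_of_gradient_row_bootstrap_two` and the sign of `ε₁·ε₀N·(S − S₀)`; for `S ≤ S₀` the every-bond form
`norm_le_of_gradient_row_bootstrap` at `b₀` is already stronger (no order hypothesis is needed — observed by the X-read chair ne9-leaf-06 g76, X125).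
(t4-ne9-idea-1 g135 N36 §4 `storeyJ_two_constants_closed`, there with `S₀ ≤ S`.) [folklore] [cite: Balaban1985BackgroundPropagators, Thm 3.1 (3.42) p.397] -/
theorem norm_le_of_gradient_row_bootstrap_two_closed (D : Y → E) (k : Y → X → 𝕂) (g V : Y → X → E) (w : X → ℝ) (w' : Y → ℝ) (hw' : ∀ b, 0 < w' b)
    {S S₀ ε₀ ε₁ ε₂ Γ N : ℝ} (hε₁ : 0 ≤ ε₁) (hε₂ : 0 ≤ ε₂) (hΓ : 0 ≤ Γ) (hN : 0 ≤ N) (hε₀N : 0 ≤ ε₀ * N) (hθ : S * ε₁ < 1)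
    (hrep : ∀ b, ‖D b‖ ≤ ‖∑ y, k b y • (g b y - V b y)‖ + ε₀ * N * w' b)
    (hk : ∀ b, ∑ y, ‖k b y‖ * w y ≤ S * w' b)
    (hg : ∀ b y, ‖g b y‖ ≤ Γ * w y)
    (hV : ∀ M : ℝ, 0 ≤ M → (∀ b, ‖D b‖ ≤ M * w' b) → ∀ b y, ‖V b y‖ ≤ (ε₁ * M + ε₂ * N) * w y)
    (b₀ : Y) (hk₀ : ∑ y, ‖k b₀ y‖ * w y ≤ S₀ * w' b₀) :
    ‖D b₀‖ ≤ (S₀ * (Γ + ε₂ * N) + ε₀ * N) / (1 - S * ε₁) * w' b₀ := by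
  have hθ' : 0 < 1 - S * ε₁ := sub_pos.mpr hθ
  rcases le_total S S₀ with hSS₀ | hS₀S
  · -- `S ≤ S₀`: the every-bond closed form at `b₀`, monotone in the data slot
    refine (norm_le_of_gradient_row_bootstrap D k g V w w' hw' hε₁ hε₂ hΓ hN hθ hrep hk hg hV b₀).trans
      (mul_le_mul_of_nonneg_right (div_le_div_of_nonneg_right ?_ hθ'.le) (hw' b₀).le)
    have hpos : 0 ≤ Γ + ε₂ * N := by positivity
    nlinarith [mul_le_mul_of_nonneg_right hSS₀ hpos]
  have h := norm_le_of_gradient_row_bootstrap_two D k g V w w' hw' hε₁ hε₂ hΓ hN hθ hrep hk hg hV b₀ hk₀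
  set M : ℝ := (S * (Γ + ε₂ * N) + ε₀ * N) / (1 - S * ε₁) with hM
  have hMT : M * (1 - S * ε₁) = S * (Γ + ε₂ * N) + ε₀ * N := by
    rw [hM]
    field_simp
  have key : S₀ * (Γ + (ε₁ * M + ε₂ * N)) + ε₀ * N ≤ (S₀ * (Γ + ε₂ * N) + ε₀ * N) / (1 - S * ε₁) := by
    rw [le_div_iff₀ hθ']
    have expand : (S₀ * (Γ + (ε₁ * M + ε₂ * N)) + ε₀ * N) * (1 - S * ε₁) =
        S₀ * (Γ + ε₂ * N) + ε₀ * N - ε₁ * (ε₀ * N) * (S - S₀) := by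
      linear_combination (S₀ * ε₁) * hMT
    rw [expand]
    nlinarith [mul_nonneg (mul_nonneg hε₁ hε₀N) (sub_nonneg.mpr hS₀S)]
  exact h.trans (mul_le_mul_of_nonneg_right key (hw' b₀).le)

/-! ## §4 Operator (solution) shape: the gradient kernel replaced by a weighted linear-response letter -/

omit [Fintype X] in
/-- **THE GRADIENT-ROW BOOTSTRAP, OPERATOR SHAPE.**  As `norm_le_of_gradient_row_bootstrap`, with the kernel row replaced by a RESPONSE map `T b : (X → E) → E`
per bond (in storey J: `T (x, μ) h = η⁻¹·(v(x + e_μ) − v(x))` for the flat solution `(L₀ + m)v = h`) and the (K∇) letter in SOLUTION SHAPE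
`hT : ‖h y‖ ≤ F·w y (∀ y) ⟹ ‖T b h‖ ≤ S·F·w′ b` — the shape of `B5Eq129FreeResolventWeightedGradientRowOperator.norm_apply_sub_le_of_resolvent_weighted`
(t4-ne9-idea-1 g121 §2 (K∇′): «then the weighted Young step collapses into this letter and the fixed point is unchanged»).  (REP) reads
`‖D b‖ ≤ ‖T b (g b − V b)‖ + ε₀·N·w′ b`; output `‖D b‖ ≤ (S·(Γ + ε₂·N) + ε₀·N)∕(1 − S·ε₁)·w′ b`.  No linearity of `T b` is used. [folklore]
[cite: Balaban1985BackgroundPropagators, Thm 3.1 (3.42) p.397] -/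
theorem norm_le_of_gradient_response_bootstrap (D : Y → E) (T : Y → (X → E) → E) (g V : Y → X → E) (w : X → ℝ) (w' : Y → ℝ)
    (hw' : ∀ b, 0 < w' b) {S ε₀ ε₁ ε₂ Γ N : ℝ} (hε₁ : 0 ≤ ε₁) (hε₂ : 0 ≤ ε₂) (hΓ : 0 ≤ Γ) (hN : 0 ≤ N) (hθ : S * ε₁ < 1)
    (hrep : ∀ b, ‖D b‖ ≤ ‖T b (fun y => g b y - V b y)‖ + ε₀ * N * w' b)
    (hT : ∀ (b : Y) (h : X → E) (F : ℝ), 0 ≤ F → (∀ y, ‖h y‖ ≤ F * w y) → ‖T b h‖ ≤ S * F * w' b)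
    (hg : ∀ b y, ‖g b y‖ ≤ Γ * w y)
    (hV : ∀ M : ℝ, 0 ≤ M → (∀ b, ‖D b‖ ≤ M * w' b) → ∀ b y, ‖V b y‖ ≤ (ε₁ * M + ε₂ * N) * w y) (b : Y) :
    ‖D b‖ ≤ (S * (Γ + ε₂ * N) + ε₀ * N) / (1 - S * ε₁) * w' b := by
  refine norm_le_weight_mul_of_bootstrap D w' hw' (A := S * (Γ + ε₂ * N) + ε₀ * N) (θ := S * ε₁) hθ ?_ b
  intro M hM0 hMb b
  have hpos : 0 ≤ Γ + (ε₁ * M + ε₂ * N) := by positivity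
  have hdat : ∀ y, ‖g b y - V b y‖ ≤ (Γ + (ε₁ * M + ε₂ * N)) * w y := fun y =>
    calc ‖g b y - V b y‖ ≤ ‖g b y‖ + ‖V b y‖ := norm_sub_le _ _
      _ ≤ Γ * w y + (ε₁ * M + ε₂ * N) * w y := add_le_add (hg b y) (hV M hM0 hMb b y)
      _ = (Γ + (ε₁ * M + ε₂ * N)) * w y := by ring
  calc ‖D b‖ ≤ ‖T b (fun y => g b y - V b y)‖ + ε₀ * N * w' b := hrep b
    _ ≤ S * (Γ + (ε₁ * M + ε₂ * N)) * w' b + ε₀ * N * w' b := add_le_add (hT b _ _ hpos hdat) le_rfl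
    _ = (S * (Γ + ε₂ * N) + ε₀ * N + S * ε₁ * M) * w' b := by ring

omit [Fintype X] in
/-- **OPERATOR SHAPE, TWO CONSTANTS**: with the read-off bond's own response letter `‖T b₀ h‖ ≤ S₀·F·w′ b₀` and `0 ≤ ε₀·N` (no order between `S₀` and `S`):
`‖D b₀‖ ≤ (S₀·(Γ + ε₂·N) + ε₀·N)∕(1 − S·ε₁)·w′ b₀` — `S` (every bond, `B5Eq129FreeResolventWeightedGradientRowOperator` §1) in the θ-slot, `S₀` (the weight centred
at the output site, ibid. §3) in the data slot. [folklore] [cite: Balaban1985BackgroundPropagators, Thm 3.1 (3.42) p.397] -/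
theorem norm_le_of_gradient_response_bootstrap_two_closed (D : Y → E) (T : Y → (X → E) → E) (g V : Y → X → E) (w : X → ℝ) (w' : Y → ℝ)
    (hw' : ∀ b, 0 < w' b) {S S₀ ε₀ ε₁ ε₂ Γ N : ℝ} (hε₁ : 0 ≤ ε₁) (hε₂ : 0 ≤ ε₂) (hΓ : 0 ≤ Γ) (hN : 0 ≤ N) (hε₀N : 0 ≤ ε₀ * N) (hθ : S * ε₁ < 1)
    (hrep : ∀ b, ‖D b‖ ≤ ‖T b (fun y => g b y - V b y)‖ + ε₀ * N * w' b)
    (hT : ∀ (b : Y) (h : X → E) (F : ℝ), 0 ≤ F → (∀ y, ‖h y‖ ≤ F * w y) → ‖T b h‖ ≤ S * F * w' b)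
    (hg : ∀ b y, ‖g b y‖ ≤ Γ * w y)
    (hV : ∀ M : ℝ, 0 ≤ M → (∀ b, ‖D b‖ ≤ M * w' b) → ∀ b y, ‖V b y‖ ≤ (ε₁ * M + ε₂ * N) * w y)
    (b₀ : Y) (hT₀ : ∀ (h : X → E) (F : ℝ), 0 ≤ F → (∀ y, ‖h y‖ ≤ F * w y) → ‖T b₀ h‖ ≤ S₀ * F * w' b₀) :
    ‖D b₀‖ ≤ (S₀ * (Γ + ε₂ * N) + ε₀ * N) / (1 - S * ε₁) * w' b₀ := by
  have hθ' : 0 < 1 - S * ε₁ := sub_pos.mpr hθ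
  have hMb : ∀ b, ‖D b‖ ≤ (S * (Γ + ε₂ * N) + ε₀ * N) / (1 - S * ε₁) * w' b :=
    norm_le_of_gradient_response_bootstrap D T g V w w' hw' hε₁ hε₂ hΓ hN hθ hrep hT hg hV
  rcases le_total S S₀ with hSS₀ | hS₀S
  · refine (hMb b₀).trans (mul_le_mul_of_nonneg_right (div_le_div_of_nonneg_right ?_ hθ'.le) (hw' b₀).le)
    have hpos : 0 ≤ Γ + ε₂ * N := by positivity
    nlinarith [mul_le_mul_of_nonneg_right hSS₀ hpos]
  set M : ℝ := (S * (Γ + ε₂ * N) + ε₀ * N) / (1 - S * ε₁) with hM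
  have hM0 : 0 ≤ M := by
    by_contra hneg
    have h1 : M * w' b₀ < 0 := mul_neg_of_neg_of_pos (not_le.mp hneg) (hw' b₀)
    linarith [hMb b₀, norm_nonneg (D b₀)]
  have hpos : 0 ≤ Γ + (ε₁ * M + ε₂ * N) := by positivity
  have hdat : ∀ y, ‖g b₀ y - V b₀ y‖ ≤ (Γ + (ε₁ * M + ε₂ * N)) * w y := fun y =>
    calc ‖g b₀ y - V b₀ y‖ ≤ ‖g b₀ y‖ + ‖V b₀ y‖ := norm_sub_le _ _
      _ ≤ Γ * w y + (ε₁ * M + ε₂ * N) * w y := add_le_add (hg b₀ y) (hV M hM0 hMb b₀ y)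
      _ = (Γ + (ε₁ * M + ε₂ * N)) * w y := by ring
  have h : ‖D b₀‖ ≤ (S₀ * (Γ + (ε₁ * M + ε₂ * N)) + ε₀ * N) * w' b₀ :=
    calc ‖D b₀‖ ≤ ‖T b₀ (fun y => g b₀ y - V b₀ y)‖ + ε₀ * N * w' b₀ := hrep b₀
      _ ≤ S₀ * (Γ + (ε₁ * M + ε₂ * N)) * w' b₀ + ε₀ * N * w' b₀ := add_le_add (hT₀ _ _ hpos hdat) le_rfl
      _ = (S₀ * (Γ + (ε₁ * M + ε₂ * N)) + ε₀ * N) * w' b₀ := by ring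
  have hMT : M * (1 - S * ε₁) = S * (Γ + ε₂ * N) + ε₀ * N := by
    rw [hM]
    field_simp
  have key : S₀ * (Γ + (ε₁ * M + ε₂ * N)) + ε₀ * N ≤ (S₀ * (Γ + ε₂ * N) + ε₀ * N) / (1 - S * ε₁) := by
    rw [le_div_iff₀ hθ']
    have expand : (S₀ * (Γ + (ε₁ * M + ε₂ * N)) + ε₀ * N) * (1 - S * ε₁) =
        S₀ * (Γ + ε₂ * N) + ε₀ * N - ε₁ * (ε₀ * N) * (S - S₀) := by
      linear_combination (S₀ * ε₁) * hMT
    rw [expand]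
    nlinarith [mul_nonneg (mul_nonneg hε₁ hε₀N) (sub_nonneg.mpr hS₀S)]
  exact h.trans (mul_le_mul_of_nonneg_right key (hw' b₀).le)

end Literature.MathematicalPhysics.QuantumFieldTheory.Balaban1983to89.B9Eq342GradientRowBootstrap
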